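import Summits.Langlands.Langlands.Theses.SenNullAlignment
import Literature.NumberTheory.Automorphic.SpecialRepresentationGL2

/-!
# Birth skeleton (BC3) for crux stmt-Langlands-16361
`Summit.Langlands.Langlands.Theses.SenNullAlignment.AwayFromEll` — line `birth`

Route `route-Langlands-SenNullAlignment` (`closes : SingularProjectiveFinite → NonAlignedAtEll →
AlignedAtEll → AwayFromEll → OddNonRegularAttached → RegularServed → SectorComplement → Langlands`).
The crux (rank 5) says: for `K` totally real, `RD` reciprocity data serving the regular Hilbert case,
`π` cuspidal on `GL₂(𝔸_K)`, L-algebraic, holomorphic of weight `(k, w)` with totally odd central sign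
and some `k_β = 1`, `ℓ`, `ι`, and every irreducible `ρ : Γ_K → GL₂(ℚ̄_ℓ)` Satake–Frobenius compatible
with `π` at almost all places, LOCAL–GLOBAL COMPATIBILITY `LocalGlobalCompatibleAt RD ι π ρ v` holds at
every finite `v ∤ ℓ`.

This file concludes the crux BY NAME from three named stubs, cut along the one seam the printed
record itself draws (Newton 2015, Thm. 1 / Rem. 3 / Thm. 4; Jarvis 1997): the dichotomy
"`π_v` special (a twist of Steinberg, tree predicate `AutomorphicRepData.IsSpecialAt`, landed with
the route's definition request D2) or not", and inside the special case the further separation of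
what congruences give (agreement up to semisimplification) from what they never give (NON-VANISHING
of the monodromy operator of `WD(ρ|_{Γ_{K_v}})`).

* `stub_nonSpecialAway` — the crux at the places `v ∤ ℓ` where `π` is NOT special.  KNOWN IN PRINT:
  Jarvis 1997 (Newton 2015, Thm. 1, second bullet: Carayol, Blasius–Rogawski, Rogawski–Tunnell,
  Taylor, Jarvis), `WD(r_{ℓ,ι}(π)|_{Γ_v})^{F-ss} ≅ σ^ι(π_v)` whenever `π_v` is not a twist of
  Steinberg; `ρ ≅ r_{ℓ,ι}(π)` by Chebotarev + Brauer–Nesbitt (both irreducible, equal Frobenius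
  traces on a density-one set).  Formally XL (transcription of a published theorem through the
  tree's `LocalLanglandsDatum` / L-normalised Satake dictionary); the route's foreseen support item
  `JarvisNonSpecial`.
* `stub_specialMonodromy` — THE OPEN CORE and nothing else: at a place `v ∤ ℓ` where `π` IS special,
  some Weil–Deligne representation attached to `ρ|_{W_{K_v}}` by the Grothendieck–Deligne recipe
  (`IsWeilDeligneOfLadic`) has monodromy `N ≠ 0` (equivalently, after Newton's reduction to an
  unramified twist of Steinberg, `ρ|_{Γ_v}` is not unramified — Newton 2015 §1.2).  Known only under
  Newton's hypotheses at `ℓ` (Thm. 4: `ℓ` unramified in `K`, `π_w` unramified `ℓ`-distinguished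
  principal series at every `w ∣ ℓ`, `ρ̄` irreducible); OPEN when `π` is special at some `w ∣ ℓ`
  ("seems to require a new idea", §1.1) — exactly the residue recorded in the crux's docstring.
* `stub_specialOfMonodromy` — the special case GIVEN non-vanishing monodromy: if `π` is special at
  `v ∤ ℓ` and some attached Weil–Deligne representation of `ρ|_{W_{K_v}}` has `N ≠ 0`, then
  `LocalGlobalCompatibleAt RD ι π ρ v`.  KNOWN IN PRINT modulo rank-2 Weil–Deligne algebra: Jarvis
  proves `WD(ρ|_{Γ_v})^{ss} ≅ σ^ι(π_v)^{ss}` in the special case (Newton 2015, Rem. 3), and a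
  two-dimensional Weil–Deligne representation with semisimplification `χ‖·‖^{1/2} ⊕ χ‖·‖^{-1/2}` and
  `N ≠ 0` is `Sp(2) ⊗ χ = rec(St ⊗ χ∘det)` up to isomorphism (Tate 1979 (4.1.4)–(4.1.5); the image of
  the special representations under `rec` is the set of classes with `N ≠ 0`, Bushnell–Henniart
  §33).  Formally XL (same transcription debt as stub 1, plus Frobenius-semisimplification
  bookkeeping `HasFrobSemisimpleClass` / `IsTransportAlong`).

The composition `AwayFromEll_of` is kernel-checked and sorry-free: at `v ∤ ℓ` it splits on
`π.1.IsSpecialAt v` (classical `by_cases`); the non-special branch is stub 1, the special branch feeds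
the attached `W` with `N ≠ 0` of stub 2 into stub 3.  Pure logic — all mathematics sits in the stubs,
none of which is the crux: stub 1 lacks the special places, stub 3 assumes the monodromy, stub 2
concludes a Galois-side statement (`N ≠ 0`), not a correspondence.

Shape (for `ledger skeleton check`): each stub is `theorem stub_<name> : <Prop> := by sorry` (closed
statements over existing declarations only: the crux's own binders verbatim, plus
`AutomorphicRepData.IsSpecialAt`, `WeilDeligneRep`, `IsWeilDeligneOfLadic`, `FramedGaloisRep.toLocal`,
`FramedRep.toWeilGroupHom`); `_Goal.stub_<name> : Prop := type_of% @stub_<name>` names that statement;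
`AwayFromEll_of (h₁ : _Goal.stub_nonSpecialAway) (h₂ : _Goal.stub_specialMonodromy)
(h₃ : _Goal.stub_specialOfMonodromy) : AwayFromEll` concludes the route decl BY NAME; the last
`example` feeds the three stubs to it.  Sorries: exactly 3, one inside each `stub_*`, none elsewhere.

BC3 AUDIT (registrar, 2026-08-17; details and raw outputs in `Lines/birth.md`): `lean check --json`
on this file: rc 0, errors [], sorries 3 — exactly the three `stub_*` declarations ("declaration uses
sorry" at their lines), zero elsewhere; `#print axioms AwayFromEll_of` = `[propext, Classical.choice,
Quot.sound]` (no `sorryAx`).  Probes (registrar's folder `bc/AwayFromEll_probe*.lean`, stub statements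
copied verbatim as `S1 S2 S3`): prescribed form `Sᵢ → AwayFromEll`, `Sᵢ → Langlands` by
`first | exact? | simpa [Sᵢ] | (unfold Sᵢ; simpa) | aesop` under `maxHeartbeats 400000` FAIL 6/6
(deterministic `whnf` timeouts); binders-first form (`unfold`, `intros`, `first | exact? | aesop |
simp_all`) FAIL 6/6; the converse costume probes `AwayFromEll → Sᵢ` FAIL 3/3 in that form as well
(S1 and S3 ARE special cases of the crux by design — a case split — but not by these tactics).  No
stub is cheaply the crux or the summit.

Disproof used: none exists — `ledger crux ls stmt-Langlands-16361` lists no workfiles (no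
`Disproof.lean`, no `Negative/` lemma, no dead line, no crux ideas) at registration time; `ledger
negatives --problem Langlands` (3 entries: SplitPrimeInductionDeinduction,
OrdinaryPrimeTransportRankinSelbergPoleCount, K3KugaSatakeDescentSerreTypeAnchor) contains nothing of
the shape of these stubs.
-/

set_option linter.dupNamespace false

noncomputable section

namespace Summit.Langlands.Langlands.Cruxes.AwayFromEll.Birth

-- the same `open`s as the route file: the crux binders (infinite idèle, `φ ∈ π.1.W`) elaborate only
-- classically (`Fintype` of the real/complex place subtypes indexing `mixedSpace K`, `DecidableEq` of places)
open scoped BigOperators Topology Manifold Classical MeasureTheory ProbabilityTheory Matrix InnerProductSpace ComplexConjugate ContinuousMap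
open Filter Set Function TopologicalSpace MeasureTheory

open Summit.Langlands.Langlands.Theses.SenNullAlignment
open Literature.NumberTheory.GaloisRepresentations Literature.NumberTheory.Automorphic

/-! ## 1. The three stubs -/

/-- **STUB 1 — local–global compatibility away from `ℓ` at the NON-SPECIAL places (Jarvis).**  In
the setting of the crux (`K` totally real; `RD` serving the regular Hilbert case; `π` cuspidal on
`GL₂(𝔸_K)`, L-algebraic, holomorphic of weight `(k, w)`, totally odd, some `k_β = 1`; `ℓ`, `ι`;
`ρ` irreducible and Satake–Frobenius compatible with `π` at almost all places), for every finite
`v ∤ ℓ` at which `π` is NOT special (`¬ π.IsSpecialAt v`: no irreducible local component of `π` at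
`v` is a twist `St ⊗ χ∘det` of the Steinberg representation): `LocalGlobalCompatibleAt RD ι π ρ v`.
In print: Newton 2015 Thm. 1 (second bullet) = Jarvis 1997 (with Carayol, Blasius–Rogawski,
Rogawski–Tunnell, Taylor), `WD(r_{ℓ,ι}(π)|_{Γ_v})^{F-ss} ≅ σ^ι(π_v)`; `ρ` is conjugate to
`r_{ℓ,ι}(π)` by Chebotarev and Brauer–Nesbitt.  Plausibly true as typed; size XL (published theorem,
transcription through `LocalLanglandsDatum` and the L-normalised Satake clause).  Why it might fail:
only through a normalisation slip (Hecke-normalised `σ(π_v)` of Jarvis/Newton versus the summit's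
untwisted `rec_v` on L-algebraic `π`; "special" is twist-invariant, so the case split is immune).
[cite: Jarvis1997, Thm. 1] [cite: Newton2015LowWeight, Thm. 1 and Rem. 3]
[cite: CarayolASENS1986] [cite: RogawskiTunnell1983] [cite: TaylorInventMath1989] -/
theorem stub_nonSpecialAway : ∀ (K : Type) [Field K] [NumberField K], NumberField.IsTotallyReal K → ∀ (RD : Summit.Langlands.ReciprocityData K), (∀ (hcpt' : Literature.NumberTheory.Automorphic.isCompact_glFiniteIntegralLevel 2 K) (π' : Literature.NumberTheory.Automorphic.CuspidalAutomorphicRepData 2 K hcpt'), π'.1.IsLAlgebraic → (∃ T : Literature.NumberTheory.Automorphic.InfinityType K 2, π'.1.HasInfinityType T ∧ T.IsRegular) → ∀ (ℓ' : ℕ) [Fact ℓ'.Prime] (ι' : PadicAlgCl ℓ' ≃+* ℂ), ∃ ρ' : Literature.NumberTheory.GaloisRepresentations.FramedGaloisRep K (PadicAlgCl ℓ') 2, ρ'.toGaloisRep.IsIrreducible ∧ Summit.Langlands.IsGeometricFramed RD ρ' ∧ Summit.Langlands.Corresponds RD ι' π'.1 ρ') → ∀ (hcpt : Literature.NumberTheory.Automorphic.isCompact_glFiniteIntegralLevel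 2 K) (π : Literature.NumberTheory.Automorphic.CuspidalAutomorphicRepData 2 K hcpt) (k : (K →+* ℂ) → ℕ) (w : ℤ), π.1.IsLAlgebraic → π.1.HasInfinityType (fun β : K →+* ℂ => ({(⟨((k β : ℂ) - 1 - w) / 2, (1 - (k β : ℂ) - w) / 2, (k β : ℤ) - 1, by push_cast; ring⟩ : Literature.NumberTheory.Automorphic.ArchWeight), (⟨((k β : ℂ) - 1 - w) / 2, (1 - (k β : ℂ) - w) / 2, (k β : ℤ) - 1, by push_cast; ring⟩ : Literature.NumberTheory.Automorphic.ArchWeight).swap} : Multiset Literature.NumberTheory.Automorphic.ArchWeight)) → (∀ (u : NumberField.InfinitePlace K), ∀ φ ∈ π.1.W, Literature.NumberTheory.Automorphic.rightTranslation (Literature.NumberTheory.Automorphic.AdelicGroupData.gl 2 K) (Matrix.GeneralLinearGroup.scalar (Fin 2) (Units.map (MonoidHom.inl (NumberField.InfiniteAdeleRing K) (IsDedekindDomain.FiniteAdeleRing (NumberField.RingOfIntegers K) K) : NumberField.InfiniteAdeleRing K →* NumberField.AdeleRing (NumberField.RingOfIntegers K) K) (Units.map (MonoidHom.mulSingle (fun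 u' : NumberField.InfinitePlace K => u'.Completion) u : u.Completion →* NumberField.InfiniteAdeleRing K) (-1)))) φ + φ ∈ π.1.W') → (∃ β : K →+* ℂ, k β = 1) → ∀ (ℓ : ℕ) [Fact ℓ.Prime] (ι : PadicAlgCl ℓ ≃+* ℂ) (ρ : Literature.NumberTheory.GaloisRepresentations.FramedGaloisRep K (PadicAlgCl ℓ) 2), ρ.toGaloisRep.IsIrreducible → (∀ᶠ v : IsDedekindDomain.HeightOneSpectrum (NumberField.RingOfIntegers K) in Filter.cofinite, Summit.Langlands.SatakeFrobCompatibleAt ι π.1 ρ v) → ∀ (v : IsDedekindDomain.HeightOneSpectrum (NumberField.RingOfIntegers K)), ((ℓ : ℕ) : NumberField.RingOfIntegers K) ∉ v.asIdeal → ¬ π.1.IsSpecialAt v → Summit.Langlands.LocalGlobalCompatibleAt RD ι π.1 ρ v := by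
  sorry

/-- **STUB 2 — non-vanishing monodromy at the SPECIAL places away from `ℓ` (the open core).**  In
the setting of the crux, for every finite `v ∤ ℓ` at which `π` IS special (`π.IsSpecialAt v`), some
Weil–Deligne representation `r` attached to `ρ|_{W_{K_v}}` by the Grothendieck–Deligne recipe
(`IsWeilDeligneOfLadic (ρ.toLocal v).toWeilGroupHom r`) has `r.N ≠ 0`.  (All attached `r` are
isomorphic — tree theorem `IsWeilDeligneOfLadic.isEquivalent_holds` — so "some" = "every"; and by
the non-degeneracy clause of `IsWeilDeligneOfLadic`, `N ≠ 0` says exactly that `ρ(I_v)` is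
infinite, Newton's "equivalently, `ρ_v` is not unramified" after his twist-and-base-change
reduction.)  Known: Newton 2015 Thm. 4 (level raising/lowering on quaternionic eigenvarieties +
Kassaei gluing + Emerton's completed cohomology of Shimura curves) under `ℓ` unramified in `K`,
`π_w ≅ Ind(μ₁ ⊗ μ₂)` unramified with `μ₁ ≠ μ₂` for all `w ∣ ℓ`, `ρ̄` irreducible.  OPEN in general —
in particular when `π` is special at some `w ∣ ℓ` (Newton §1.1: "seems to require a new idea"),
and purity, which settles the regular-weight analogue, is unavailable for congruence-built `ρ`.
Size: open problem (the crux's recorded residue, isolated).  Why it might fail: it cannot fail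
without the crux failing (LGC at a special `v` forces `N ≠ 0`), i.e. only if some partial weight
one `π`, Steinberg at `v ∤ ℓ`, had `ρ_{π,ι}` unramified at `v` — contradicting Langlands–Fontaine–
Mazur but not any proved theorem.
[cite: Newton2015LowWeight, Thm. 4 and §1.1–1.2] [cite: Jarvis1997]
[cite: DeligneAntwerpII1973, §8.4.2] -/
theorem stub_specialMonodromy : ∀ (K : Type) [Field K] [NumberField K], NumberField.IsTotallyReal K → ∀ (RD : Summit.Langlands.ReciprocityData K), (∀ (hcpt' : Literature.NumberTheory.Automorphic.isCompact_glFiniteIntegralLevel 2 K) (π' : Literature.NumberTheory.Automorphic.CuspidalAutomorphicRepData 2 K hcpt'), π'.1.IsLAlgebraic → (∃ T : Literature.NumberTheory.Automorphic.InfinityType K 2, π'.1.HasInfinityType T ∧ T.IsRegular) → ∀ (ℓ' : ℕ) [Fact ℓ'.Prime] (ι' : PadicAlgCl ℓ' ≃+* ℂ), ∃ ρ' : Literature.NumberTheory.GaloisRepresentations.FramedGaloisRep K (PadicAlgCl ℓ') 2, ρ'.toGaloisRep.IsIrreducible ∧ Summit.Langlands.IsGeometricFramed RD ρ' ∧ Summit.Langlands.Corresponds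 RD ι' π'.1 ρ') → ∀ (hcpt : Literature.NumberTheory.Automorphic.isCompact_glFiniteIntegralLevel 2 K) (π : Literature.NumberTheory.Automorphic.CuspidalAutomorphicRepData 2 K hcpt) (k : (K →+* ℂ) → ℕ) (w : ℤ), π.1.IsLAlgebraic → π.1.HasInfinityType (fun β : K →+* ℂ => ({(⟨((k β : ℂ) - 1 - w) / 2, (1 - (k β : ℂ) - w) / 2, (k β : ℤ) - 1, by push_cast; ring⟩ : Literature.NumberTheory.Automorphic.ArchWeight), (⟨((k β : ℂ) - 1 - w) / 2, (1 - (k β : ℂ) - w) / 2, (k β : ℤ) - 1, by push_cast; ring⟩ : Literature.NumberTheory.Automorphic.ArchWeight).swap} : Multiset Literature.NumberTheory.Automorphic.ArchWeight)) → (∀ (u : NumberField.InfinitePlace K), ∀ φ ∈ π.1.W, Literature.NumberTheory.Automorphic.rightTranslation (Literature.NumberTheory.Automorphic.AdelicGroupData.gl 2 K) (Matrix.GeneralLinearGroup.scalar (Fin 2) (Units.map (MonoidHom.inl (NumberField.InfiniteAdeleRing K) (IsDedekindDomain.FiniteAdeleRing (NumberField.RingOfIntegers K) K) : NumberField.InfiniteAdeleRing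 K →* NumberField.AdeleRing (NumberField.RingOfIntegers K) K) (Units.map (MonoidHom.mulSingle (fun u' : NumberField.InfinitePlace K => u'.Completion) u : u.Completion →* NumberField.InfiniteAdeleRing K) (-1)))) φ + φ ∈ π.1.W') → (∃ β : K →+* ℂ, k β = 1) → ∀ (ℓ : ℕ) [Fact ℓ.Prime] (ι : PadicAlgCl ℓ ≃+* ℂ) (ρ : Literature.NumberTheory.GaloisRepresentations.FramedGaloisRep K (PadicAlgCl ℓ) 2), ρ.toGaloisRep.IsIrreducible → (∀ᶠ v : IsDedekindDomain.HeightOneSpectrum (NumberField.RingOfIntegers K) in Filter.cofinite, Summit.Langlands.SatakeFrobCompatibleAt ι π.1 ρ v) → ∀ (v : IsDedekindDomain.HeightOneSpectrum (NumberField.RingOfIntegers K)), ((ℓ : ℕ) : NumberField.RingOfIntegers K) ∉ v.asIdeal → π.1.IsSpecialAt v → ∃ r : Literature.NumberTheory.GaloisRepresentations.WeilDeligneRep (v.adicCompletion K) (PadicAlgCl ℓ) (Fin 2 → PadicAlgCl ℓ), Literature.NumberTheory.GaloisRepresentations.IsWeilDeligneOfLadic (ρ.toLocal v).toWeilGroupHom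 r ∧ r.N ≠ 0 := by
  sorry

/-- **STUB 3 — the special case, GIVEN the monodromy.**  In the setting of the crux, for every
finite `v ∤ ℓ` at which `π` is special, IF some Weil–Deligne representation attached to
`ρ|_{W_{K_v}}` has `N ≠ 0` THEN `LocalGlobalCompatibleAt RD ι π ρ v`.  In print modulo rank-two
Weil–Deligne algebra: Jarvis proves `WD(ρ|_{Γ_v})^{ss} ≅ σ^ι(π_v)^{ss}` at special `v` (Newton 2015
Rem. 3; traces vary continuously in the congruence family and match by Carayol at regular
weights), `σ(St ⊗ χ∘det) = Sp(2) ⊗ χ` (the special representations are exactly the classes with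
`N ≠ 0` under `rec`), and a two-dimensional Weil–Deligne representation with semisimplification
`χ‖·‖^{1/2} ⊕ χ‖·‖^{-1/2}` and `N ≠ 0` is isomorphic to `Sp(2) ⊗ χ`, which is Frobenius-semisimple
(Tate 1979 (4.1.4)–(4.1.5)); the witnesses of `LocalGlobalCompatibleAt` are then `π_v` (Flath,
`exists_hasLocalComponentAt`), the attached `r`, and `rℂ = ι(r)`.  Size XL (transcription, as stub
1, plus `HasFrobSemisimpleClass` / `IsTransportAlong` bookkeeping).  Why it might fail: as stub 1,
only through the Hecke-versus-L normalisation of `rec_v` (a twist slip would mismatch the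
semisimplifications, not the monodromy).
[cite: Newton2015LowWeight, Rem. 3] [cite: Jarvis1997] [cite: TateCorvallis1979, (4.1.4)–(4.2.1)]
[cite: JacquetLanglands1970, Thm. 3.3 (ii)] [cite: CarayolASENS1986] -/
theorem stub_specialOfMonodromy : ∀ (K : Type) [Field K] [NumberField K], NumberField.IsTotallyReal K → ∀ (RD : Summit.Langlands.ReciprocityData K), (∀ (hcpt' : Literature.NumberTheory.Automorphic.isCompact_glFiniteIntegralLevel 2 K) (π' : Literature.NumberTheory.Automorphic.CuspidalAutomorphicRepData 2 K hcpt'), π'.1.IsLAlgebraic → (∃ T : Literature.NumberTheory.Automorphic.InfinityType K 2, π'.1.HasInfinityType T ∧ T.IsRegular) → ∀ (ℓ' : ℕ) [Fact ℓ'.Prime] (ι' : PadicAlgCl ℓ' ≃+* ℂ), ∃ ρ' : Literature.NumberTheory.GaloisRepresentations.FramedGaloisRep K (PadicAlgCl ℓ') 2, ρ'.toGaloisRep.IsIrreducible ∧ Summit.Langlands.IsGeometricFramed RD ρ' ∧ Summit.Langlands.Corresponds RD ι' π'.1 ρ') → ∀ (hcpt : Literature.NumberTheory.Automorphic.isCompact_glFiniteIntegralLevel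 2 K) (π : Literature.NumberTheory.Automorphic.CuspidalAutomorphicRepData 2 K hcpt) (k : (K →+* ℂ) → ℕ) (w : ℤ), π.1.IsLAlgebraic → π.1.HasInfinityType (fun β : K →+* ℂ => ({(⟨((k β : ℂ) - 1 - w) / 2, (1 - (k β : ℂ) - w) / 2, (k β : ℤ) - 1, by push_cast; ring⟩ : Literature.NumberTheory.Automorphic.ArchWeight), (⟨((k β : ℂ) - 1 - w) / 2, (1 - (k β : ℂ) - w) / 2, (k β : ℤ) - 1, by push_cast; ring⟩ : Literature.NumberTheory.Automorphic.ArchWeight).swap} : Multiset Literature.NumberTheory.Automorphic.ArchWeight)) → (∀ (u : NumberField.InfinitePlace K), ∀ φ ∈ π.1.W, Literature.NumberTheory.Automorphic.rightTranslation (Literature.NumberTheory.Automorphic.AdelicGroupData.gl 2 K) (Matrix.GeneralLinearGroup.scalar (Fin 2) (Units.map (MonoidHom.inl (NumberField.InfiniteAdeleRing K) (IsDedekindDomain.FiniteAdeleRing (NumberField.RingOfIntegers K) K) : NumberField.InfiniteAdeleRing K →* NumberField.AdeleRing (NumberField.RingOfIntegers K) K) (Units.map (MonoidHom.mulSingle (fun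 u' : NumberField.InfinitePlace K => u'.Completion) u : u.Completion →* NumberField.InfiniteAdeleRing K) (-1)))) φ + φ ∈ π.1.W') → (∃ β : K →+* ℂ, k β = 1) → ∀ (ℓ : ℕ) [Fact ℓ.Prime] (ι : PadicAlgCl ℓ ≃+* ℂ) (ρ : Literature.NumberTheory.GaloisRepresentations.FramedGaloisRep K (PadicAlgCl ℓ) 2), ρ.toGaloisRep.IsIrreducible → (∀ᶠ v : IsDedekindDomain.HeightOneSpectrum (NumberField.RingOfIntegers K) in Filter.cofinite, Summit.Langlands.SatakeFrobCompatibleAt ι π.1 ρ v) → ∀ (v : IsDedekindDomain.HeightOneSpectrum (NumberField.RingOfIntegers K)), ((ℓ : ℕ) : NumberField.RingOfIntegers K) ∉ v.asIdeal → π.1.IsSpecialAt v → (∃ r : Literature.NumberTheory.GaloisRepresentations.WeilDeligneRep (v.adicCompletion K) (PadicAlgCl ℓ) (Fin 2 → PadicAlgCl ℓ), Literature.NumberTheory.GaloisRepresentations.IsWeilDeligneOfLadic (ρ.toLocal v).toWeilGroupHom r ∧ r.N ≠ 0) → Summit.Langlands.LocalGlobalCompatibleAt RD ι π.1 ρ v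 := by
  sorry

/-! ## 2. The stub statements as named propositions (the composition's hypotheses, by name)

`_Goal` is internal on purpose: audits listing the file's declarations by short name find the `stub_*`
THEOREMS, while the skeleton check accepts the hypotheses of `AwayFromEll_of` by the stub names they
carry.  Each `_Goal.stub_x` is `type_of% @stub_x` — no text duplicated, no `sorry` inherited. -/

namespace _Goal

/-- The statement of `stub_nonSpecialAway`, as a named `Prop` (literally its type). [folklore] -/
def stub_nonSpecialAway : Prop :=
  type_of% @Summit.Langlands.Langlands.Cruxes.AwayFromEll.Birth.stub_nonSpecialAway

/-- The statement of `stub_specialMonodromy`, as a named `Prop` (literally its type). [folklore] -/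
def stub_specialMonodromy : Prop :=
  type_of% @Summit.Langlands.Langlands.Cruxes.AwayFromEll.Birth.stub_specialMonodromy

/-- The statement of `stub_specialOfMonodromy`, as a named `Prop` (literally its type). [folklore] -/
def stub_specialOfMonodromy : Prop :=
  type_of% @Summit.Langlands.Langlands.Cruxes.AwayFromEll.Birth.stub_specialOfMonodromy

end _Goal

/-! ## 3. The composition (kernel-checked, no `sorry`): special / non-special dichotomy at `v ∤ ℓ` -/

/-- **`AwayFromEll` from the three stubs.**  At a finite `v ∤ ℓ`: either `π` is not special at `v`
and stub 1 is the conclusion, or it is, stub 2 attaches a Weil–Deligne representation with `N ≠ 0`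
to `ρ|_{W_{K_v}}`, and stub 3 turns that into `LocalGlobalCompatibleAt RD ι π ρ v`.  The hypotheses
are, by name, the statements of `stub_nonSpecialAway`, `stub_specialMonodromy`,
`stub_specialOfMonodromy`; the conclusion is the route decl. [folklore] -/
theorem AwayFromEll_of (h₁ : _Goal.stub_nonSpecialAway) (h₂ : _Goal.stub_specialMonodromy)
    (h₃ : _Goal.stub_specialOfMonodromy) : AwayFromEll := by
  unfold _Goal.stub_nonSpecialAway at h₁
  unfold _Goal.stub_specialMonodromy at h₂
  unfold _Goal.stub_specialOfMonodromy at h₃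
  intro K _ _ hK RD hreg hcpt π k w hL hhol hodd hne ℓ _ ι ρ hirr hae v hv
  by_cases hsp : π.1.IsSpecialAt v
  · -- special at `v`: non-vanishing monodromy (stub 2) fed into the special case (stub 3)
    exact h₃ K hK RD hreg hcpt π k w hL hhol hodd hne ℓ ι ρ hirr hae v hv hsp
      (h₂ K hK RD hreg hcpt π k w hL hhol hodd hne ℓ ι ρ hirr hae v hv hsp)
  · -- not special at `v`: Jarvis (stub 1)
    exact h₁ K hK RD hreg hcpt π k w hL hhol hodd hne ℓ ι ρ hirr hae v hv hsp

/-- By-name sanity check (an `example`, not a declaration of the file): the three stubs feed the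
composition as they stand. -/
example : AwayFromEll :=
  AwayFromEll_of stub_nonSpecialAway stub_specialMonodromy stub_specialOfMonodromy

end Summit.Langlands.Langlands.Cruxes.AwayFromEll.Birth

end
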